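import Literature.AlgebraicGeometry.AbelianSchemes.AbelianSchemeDualPairSlice
import Literature.AlgebraicGeometry.AbelianSchemes.FibreHomPointsOfFibrePoints
import Literature.AlgebraicGeometry.AbelianVarieties.AbelianVarietyWeilDivisorBundleDictionary
import Literature.AlgebraicGeometry.Motives.AbelianVarietyPicZeroOfAmple
import HarnessLib

/-!
# A polarisation is ONTO on complex fibre points: `λ̄_t : A_t(ℂ) → Â_t(ℂ)` is surjective (Mumford §8 Thm. 1, Milne I §8)

Layer `Literature/AlgebraicGeometry/AbelianSchemes`, namespaces
`Literature.AlgebraicGeometry.AbelianSchemes.AbelianSchemeOver.DualPair` (§1) and `….AbelianSchemeOver.Polarization` (§2).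
THEOREMS ONLY (no definition, no named fact, no instance, no `sorry`).

Setting: an abelian scheme `A/S` (`S : Scheme.{0}`) with a dual pair `D = (Â, 𝒫)` (★ `DualPair`, [MilneAV2008] I §8:
`Â` represents rigidified fibrewise-`Pic⁰` line bundles on `A`, uniquely) and a polarisation `λ : A → Â` (★ `Polarization`,
[MumfordFogartyKirwan1994] Def. 6.3: at every geometric point `λ̄ = Λ(𝒪(Θ))` for an AMPLE `Θ`, ★ `IsLambdaOfAt`), and a
COMPLEX point `t : Spec ℂ → S`.

* §1 `DualPair.exists_nonempty_slice_iso_translateTensorDual` — every `ℂ`-point `b` of `Â` over `t` has its `𝒫`-slice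
  `𝒫|_{A_t × {b}}` isomorphic to a Mumford bundle `t_a^*𝒪(Θ) ⊗ 𝒪(Θ)⁻¹`, `a ∈ A_t(ℂ)`, for ANY ample `Θ` on `A_t`:
  the slice is a homogeneous line bundle (clause (a) of the dual pair, ★ `isHomogeneous_pullback_sliceOver`), hence
  `≅ 𝒪(D₀)` with `t_x^*D₀ ∼ D₀` for all `x` (★ `isHomogeneous_iff_exists_iso_lineBundle`), hence `D₀ ∼ t_a^*Θ − Θ`
  by **Mumford §8 Theorem 1 over `ℂ`** (★ `exists_linEquiv_weilDiv_of_forall_translate_linEquiv`, the analytic proof),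
  and `[𝒪(t_a^*Θ − Θ)] = [t_a^*𝒪(Θ) ⊗ 𝒪(Θ)⁻¹]` (★ `detClass_translateTensorDual_eq_cechClass_weilDiv`,
  ★ `nonempty_iso_iff_detClass_eq`).
* §2 **`Polarization.exists_valueAt_eq_of_complexPoint`** — `λ̄_t` is ONTO: every `b ∈ Â_t(ℂ)` is `λ̄(a)` (§1 with the
  ample witness `Θ` of `pol.exists_ample ℂ t`, then `IsLambdaOfAt` identifies the Mumford bundle with the slice at `λ̄(a)`,
  and «`b ↦ [𝒫|_{A_t × {b}}]` is injective», ★ `DualPair.eq_of_nonempty_iso` with the slice bundle ★ `sliceBundle` as test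
  object); **`Polarization.exists_comp_lam_eq_of_complexPoint`** — the same in the `FibrePoints` currency
  (`∀ y : Â.FibrePoints t, ∃ x : A.FibrePoints t, x ≫ λ = y`) through the ★ `FibreHomPointsOfFibrePoints` dictionary.

This is the COMPLEX-POINT half of the `hsurj` binder of ★ `PolarizedAbelianSchemeWithLevel.exists_hatLevelStructure`
(`AbelianSchemes/PolarizationHatLevelStructure`); the passage to an arbitrary algebraically closed `Ω` (for bases locally
of finite type over `ℂ`) is by Steinitz–Lefschetz factorisation of geometric points through `Spec ℂ` and the
`n`-torsion count, in the sequel files.  Cell `hodgecm-mathlib` (D-0151), HECKE-LINK D6 (u5) residual; count-neutral;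
HC_CM is proved only modulo the 7 printed citations until rung 0 closes.

## References
* [MumfordAV1970] D. Mumford, *Abelian Varieties* (1970), §8 Theorem 1 (p. 77) («`Λ(L)` is surjective for `L` ample»),
  §8 (iv) ⇔ (i) (definition of `Pic⁰`).
* [MilneAV2008] J. S. Milne, *Abelian Varieties* (v2.00, 2008), I §8 pp. 36–37 (the dual as a universal pair; uniqueness
  of the classifying map).
* [MumfordFogartyKirwan1994] D. Mumford, J. Fogarty, F. Kirwan, *Geometric Invariant Theory*, 3rd ed. (1994), Ch. 6 §2
  Def. 6.2–6.3 (p. 120).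
-/

set_option autoImplicit false

noncomputable section

open CategoryTheory CategoryTheory.Limits AlgebraicGeometry MonoidalCategory

-- `Scheme.Modules` / `(A.fibre t).toAbelianVariety.X.left = pullback A.X.hom t` hold by `rfl` only.
set_option backward.isDefEq.respectTransparency false

namespace Literature.AlgebraicGeometry.AbelianSchemes

namespace AbelianSchemeOver

open Literature.AlgebraicGeometry.Motives Literature.AlgebraicGeometry.AbelianVarieties
  Literature.AlgebraicGeometry.Modules
open scoped MonObj

variable {S : Scheme.{0}} {A : AbelianSchemeOver S} (D : A.DualPair)

/-! ## §1 Over `ℂ`, every `𝒫`-slice is a Mumford bundle `t_a^*𝒪(Θ) ⊗ 𝒪(Θ)⁻¹` -/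

namespace DualPair

/-- **Every `𝒫`-slice over a complex point is a Mumford bundle**: for `b ∈ Â_t(ℂ)` (`b ≫ π̂ = t`) and ANY ample Cartier
divisor `Θ` on the complex abelian variety `A_t`, there is `a ∈ A_t(ℂ)` with `𝒫|_{A_t × {b}} ≅ t_a^*𝒪(Θ) ⊗ 𝒪(Θ)⁻¹` —
clause (a) of the dual pair makes the slice homogeneous, a homogeneous line bundle is `𝒪(D₀)` with `t_x^*D₀ ∼ D₀`, and
Mumford's §8 Theorem 1 (over `ℂ`, ★ `exists_linEquiv_weilDiv_of_forall_translate_linEquiv`) gives `D₀ ∼ t_a^*Θ − Θ`.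
[cite: MumfordAV1970, §8 Theorem 1 (p. 77)] [cite: MilneAV2008, I §8 pp. 36–37] -/
theorem exists_nonempty_slice_iso_translateTensorDual (t : Spec (.of ℂ) ⟶ S) (b : Spec (.of ℂ) ⟶ D.hat.X.left)
    (hb : b ≫ D.hat.X.hom = t) {Θ : CartierDivisor (A.fibre t).toAbelianVariety.X.left} (hΘ : Θ.IsAmple) :
    ∃ a : (A.fibre t).toAbelianVariety.Points ℂ,
      Nonempty ((Scheme.Modules.pullback (D.sliceOver b t hb)).obj D.P ≅
        tensorObj
          ((Scheme.Modules.pullback ((A.fibre t).toAbelianVariety.translation a).left).obj (A.lineBundleOfDivisor t Θ))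
          (Modules.dual (A.lineBundleOfDivisor t Θ))) := by
  -- the slice as a rank-one homogeneous module on the complex abelian variety `A_t`
  let E : (A.fibre t).toAbelianVariety.X.left.Modules := (Scheme.Modules.pullback (D.sliceOver b t hb)).obj D.P
  have hE1 : HasRank E 1 := hasRank_pullback _ D.hasRank_one
  have hhom : IsHomogeneous (A.fibre t).toAbelianVariety E := D.isHomogeneous_pullback_sliceOver b hb
  -- `E ≅ 𝒪(D₀)` with `t_x^* D₀ ∼ D₀` for every `x`
  obtain ⟨D₀, -, ⟨φ⟩⟩ := (isHomogeneous_iff_exists_iso_lineBundle (A.fibre t).toAbelianVariety hE1).1 hhom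
  have hD₀ : ∀ x : (A.fibre t).toAbelianVariety.Points ℂ,
      (D₀.pullback ((A.fibre t).toAbelianVariety.translation x).left).LinEquiv D₀ :=
    (isHomogeneous_iff_forall_linEquiv_of_iso (A.fibre t).toAbelianVariety φ).1 hhom
  -- Mumford §8 Theorem 1 over `ℂ`: `D₀ ∼ t_a^*Θ − Θ`
  obtain ⟨a, ha⟩ :=
    (A.fibre t).toAbelianVariety.exists_linEquiv_weilDiv_of_forall_translate_linEquiv hΘ D₀ hD₀
  refine ⟨a, ?_⟩
  -- compare determinant classes in `Ȟ¹(A_t, 𝒪^×)`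
  have hM1 : HasRank (tensorObj
      ((Scheme.Modules.pullback ((A.fibre t).toAbelianVariety.translation a).left).obj (A.lineBundleOfDivisor t Θ))
      (Modules.dual (A.lineBundleOfDivisor t Θ))) 1 :=
    hasRank_tensorObj_one (hasRank_pullback _ Θ.toUnitCocycle.hasRank_lineBundle)
      (hasRank_dual Θ.toUnitCocycle.hasRank_lineBundle)
  refine (nonempty_iso_iff_detClass_eq hE1 hM1 (HasRank.isFiniteLocallyFree' hE1)
    (HasRank.isFiniteLocallyFree' hM1)).2 ?_
  rw [detClass_eq_cechClass_of_iso φ (HasRank.isFiniteLocallyFree' hE1),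
    detClass_translateTensorDual_eq_cechClass_weilDiv (A.fibre t).toAbelianVariety Θ a]
  exact ha.cechClass_eq

end DualPair

/-! ## §2 `λ̄_t` is onto on complex points -/

namespace Polarization

variable {D} (pol : A.Polarization D)

/-- **A polarisation is ONTO on complex fibre points** ([MumfordAV1970] §8 Thm. 1 + [MilneAV2008] I §8 uniqueness): for
`t : Spec ℂ → S` and every `ℂ`-point `b` of `Â` over `t` there is `P ∈ A_t(ℂ)` with `λ̄(P) = b` — by §1 the slice at
`b` is `t_P^*𝒪(Θ) ⊗ 𝒪(Θ)⁻¹` for the ample witness `Θ` of `λ̄ = Λ(𝒪(Θ))` at `t`, which is also the slice at `λ̄(P)`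
(★ `IsLambdaOfAt`), and `b ↦ [𝒫|_{A_t × {b}}]` is injective (★ `DualPair.eq_of_nonempty_iso`).
[cite: MumfordAV1970, §8 Theorem 1 (p. 77)] [cite: MilneAV2008, I §8 pp. 36–37] -/
theorem exists_valueAt_eq_of_complexPoint (t : Spec (.of ℂ) ⟶ S) (b : Spec (.of ℂ) ⟶ D.hat.X.left)
    (hb : b ≫ D.hat.X.hom = t) :
    ∃ P : (A.fibre t).toAbelianVariety.Points ℂ, pol.valueAt t P = b := by
  obtain ⟨Θ, hΘ, hΛ⟩ := pol.exists_ample ℂ t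
  obtain ⟨P, ⟨e⟩⟩ := D.exists_nonempty_slice_iso_translateTensorDual t b hb hΘ
  obtain ⟨i⟩ := AbelianSchemeOver.IsLambdaOfAt.nonempty_iso A t D pol.lam hΛ P
  refine ⟨P, (D.eq_of_nonempty_iso t (D.sliceBundle (pol.valueAt t P) t (A.valueAt_comp_hom t D pol.lam P))
    (D.sliceBundle_fibrewisePicZero _ t _) b (pol.valueAt t P) hb (A.valueAt_comp_hom t D pol.lam P)
    ⟨e ≪≫ i.symm⟩ ⟨Iso.refl _⟩).symm⟩

/-- **A polarisation is ONTO on complex fibre points, `FibrePoints` currency**: for `t : Spec ℂ → S`, every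
`y : Spec ℂ →_S Â` over `t` is `x ≫ λ` for some `x : Spec ℂ →_S A` over `t` (the previous theorem through the ★
`FibreHomPointsOfFibrePoints` dictionary `fibrePointToLeft t P = x.left`).  This is the `hsurj` binder of ★
`PolarizedAbelianSchemeWithLevel.exists_hatLevelStructure` AT COMPLEX POINTS.
[cite: MumfordAV1970, §8 Theorem 1 (p. 77)] [cite: MilneAV2008, I §8 pp. 36–37] -/
theorem exists_comp_lam_eq_of_complexPoint (t : Spec (.of ℂ) ⟶ S) (y : D.hat.FibrePoints t) :
    ∃ x : A.FibrePoints t, x ≫ pol.lam = y := by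
  obtain ⟨P, hP⟩ := pol.exists_valueAt_eq_of_complexPoint t y.left (Over.w y)
  exact ⟨Over.homMk (A.fibrePointToLeft t P) (A.fibrePointToLeft_comp_hom t P), Over.OverMorphism.ext hP⟩

end Polarization

end AbelianSchemeOver

end Literature.AlgebraicGeometry.AbelianSchemes

end
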